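import Mathlib
import Summits.Ventures.PercRepro2.Star3Main

/-!
# THE THREE-PIN STAR: (HCOV) on the star and the chain's row (blind cell PercRepro2, night-1 g27;
proofs/NIGHT1-G26.md §7 (5))

**`HCov_three_pin_star`**: (HCOV) for `a₃` with exactly the three edges `g = {a₃, o}`, `e = {a₃, a₁}`,
`d = {a₃, a₂}` — p5's root-edge closure `HCov_of_update_zero` at `e` and `HCov_of_update_zero_right` at `d`
from typer-1's `HCov_pendant_o` at `p[e ↦ 0][d ↦ 0]` (where `a₃` is a leaf at `o`) through g23's support
transport.  **`dz2Chord_o_edge_of_three_pin_star`**: the chain's row `NMixChord normDZ2` along `{o, a₁}` on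
the three-pin star, by g22's weakening `nMixChord_DZ2_of_DZ` from `dzChord_o_edge_of_three_pin_star` and (HCOV)
at `p[f ↦ 0]`; the root mirror (the chord along `{o, a₂}`, `dzChord_o_edge₂_of_three_pin_star`,
`dz2Chord_o_edge₂_of_three_pin_star`) by the symmetry of the `D·Z`-chord in the roots.  Own code; standard axioms.
-/

namespace Summit.Ventures.PercRepro2

open UnionCluster CovForm

namespace Mix

open OStar

namespace OStar3

section Row

variable {V : Type*} {E : Type*} [Fintype E] [DecidableEq E] [Fintype V] [DecidableEq V] {R : Type*}
  [Field R] [LinearOrder R] [IsStrictOrderedRing R]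

variable (p : E → R) (ends : E → Sym2 V) {o a₁ a₂ a₃ : V} (b : V) {g e d f : E}

/-- **(HCOV) on the three-pin star**: the root-edge closures at `e = {a₃, a₁}` and `d = {a₃, a₂}` from the leaf
at `o` (through the support transport, `e`, `d` having weight `0` in `p[e ↦ 0][d ↦ 0]`). -/
theorem HCov_three_pin_star (hp : IsProbVec p) (hg : ends g = s(a₃, o)) (he : ends e = s(a₃, a₁))
    (hd : ends d = s(a₃, a₂)) (hstar3 : ∀ e', a₃ ∈ ends e' → e' = g ∨ e' = e ∨ e' = d)
    (h12 : a₁ ≠ a₂) (h13 : a₁ ≠ a₃) (h23 : a₂ ≠ a₃) (ho3 : o ≠ a₃) (hb3 : b ≠ a₃) :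
    HCov p ends o a₁ a₂ a₃ b := by
  have hed : e ≠ d := star3_ne_ed ends he hd h12 h23
  have hp0 : IsProbVec (Function.update p e 0) := hp.update e le_rfl zero_le_one
  have hp00 : IsProbVec (Function.update (Function.update p e 0) d 0) := hp0.update d le_rfl zero_le_one
  have h00 : HCov (Function.update (Function.update p e 0) d 0) ends o a₁ a₂ a₃ b := by
    have hleaf : ∀ e', a₃ ∈ ends e' → e' ≠ g → Function.update (Function.update p e 0) d 0 e' = 0 := by
      intro e' h3 hne
      rcases hstar3 e' h3 with h | h | h
      · exact absurd h hne
      · rw [h, Function.update_of_ne hed, Function.update_self]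
      · rw [h, Function.update_self]
    have hS := Support.leafSupport_zero (Function.update (Function.update p e 0) d 0) ends hleaf
    rw [Support.HCov_restrict_iff _ hS ends o a₁ a₂ a₃ b]
    exact PendantO.HCov_pendant_o _ _ (Support.isProbVec_restrict _ _ hp00)
      (f := ⟨g, Support.self_mem_leafSupport ends⟩) hg (Support.leaf_restrict ends _) ho3.symm h13.symm
      h23.symm hb3
  have h0 : HCov (Function.update p e 0) ends o a₁ a₂ a₃ b :=
    RootEdge.HCov_of_update_zero_right (Function.update p e 0) hp0 ends o a₁ a₂ a₃ b d
      (by rw [hd, Sym2.eq_swap]) h00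
  exact RootEdge.HCov_of_update_zero p hp ends o a₁ a₂ a₃ b e (by rw [he, Sym2.eq_swap]) h0

/-- **The chain's row on the three-pin star**: the `(D·Z)²`-chord `NMixChord normDZ2` along `{o, a₁}`. -/
theorem dz2Chord_o_edge_of_three_pin_star (hp : IsProbVec p) (hf : ends f = s(o, a₁))
    (hg : ends g = s(a₃, o)) (he : ends e = s(a₃, a₁)) (hd : ends d = s(a₃, a₂))
    (hstar3 : ∀ e', a₃ ∈ ends e' → e' = g ∨ e' = e ∨ e' = d)
    (h12 : a₁ ≠ a₂) (h13 : a₁ ≠ a₃) (h23 : a₂ ≠ a₃) (ho1 : o ≠ a₁) (ho2 : o ≠ a₂) (ho3 : o ≠ a₃)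
    (hb3 : b ≠ a₃) :
    NMixChord (normDZ2 ends a₁ a₂ a₃) p ends o a₁ a₂ a₃ b f :=
  nMixChord_DZ2_of_DZ hp
    (dzChord_o_edge_of_three_pin_star p ends b hp hf hg he hd hstar3 h12 h13 h23 ho1 ho2 ho3 hb3)
    (HCov_three_pin_star (Function.update p f 0) ends b (hp.update f le_rfl zero_le_one) hg he hd hstar3 h12
      h13 h23 ho3 hb3)

/-! ## The root mirror: the chord along `{o, a₂}` -/

omit [Fintype V] [DecidableEq V] [IsStrictOrderedRing R] in
/-- The `D·Z`-chord is symmetric in the roots. -/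
lemma nMixChord_normDZ_root_swap (o a₁ a₂ a₃ : V) (f : E) :
    NMixChord (normDZ ends a₂ a₁ a₃) p ends o a₂ a₁ a₃ b f ↔
      NMixChord (normDZ ends a₁ a₂ a₃) p ends o a₁ a₂ a₃ b f := by
  unfold NMixChord normDZ
  rw [Gc_swap p, Gc_swap (Function.update p f 0), Gc_swap (Function.update p f 1), PDEvent_root_swap,
    avoidAll_root_swap]

omit [Fintype E] [DecidableEq E] [Fintype V] [DecidableEq V] [Field R] [LinearOrder R] [IsStrictOrderedRing R] in
/-- The star hypothesis with the roots swapped. -/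
lemma hstar3_swap (hstar3 : ∀ e', a₃ ∈ ends e' → e' = g ∨ e' = e ∨ e' = d) :
    ∀ e', a₃ ∈ ends e' → e' = g ∨ e' = d ∨ e' = e := fun e' h => by
  rcases hstar3 e' h with h | h | h
  · exact Or.inl h
  · exact Or.inr (Or.inr h)
  · exact Or.inr (Or.inl h)

/-- **The three-pin star at the root `a₂`: the `D·Z`-chord along `{o, a₂}`.** -/
theorem dzChord_o_edge₂_of_three_pin_star (hp : IsProbVec p) (hf : ends f = s(o, a₂))
    (hg : ends g = s(a₃, o)) (he : ends e = s(a₃, a₁)) (hd : ends d = s(a₃, a₂))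
    (hstar3 : ∀ e', a₃ ∈ ends e' → e' = g ∨ e' = e ∨ e' = d)
    (h12 : a₁ ≠ a₂) (h13 : a₁ ≠ a₃) (h23 : a₂ ≠ a₃) (ho1 : o ≠ a₁) (ho2 : o ≠ a₂) (ho3 : o ≠ a₃)
    (hb3 : b ≠ a₃) :
    NMixChord (normDZ ends a₁ a₂ a₃) p ends o a₁ a₂ a₃ b f :=
  (nMixChord_normDZ_root_swap p ends b o a₁ a₂ a₃ f).1
    (dzChord_o_edge_of_three_pin_star p ends b hp hf hg hd he (hstar3_swap ends hstar3) h12.symm h23 h13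
      ho2 ho1 ho3 hb3)

/-- **The chain's row on the three-pin star at the root `a₂`**: `NMixChord normDZ2` along `{o, a₂}`. -/
theorem dz2Chord_o_edge₂_of_three_pin_star (hp : IsProbVec p) (hf : ends f = s(o, a₂))
    (hg : ends g = s(a₃, o)) (he : ends e = s(a₃, a₁)) (hd : ends d = s(a₃, a₂))
    (hstar3 : ∀ e', a₃ ∈ ends e' → e' = g ∨ e' = e ∨ e' = d)
    (h12 : a₁ ≠ a₂) (h13 : a₁ ≠ a₃) (h23 : a₂ ≠ a₃) (ho1 : o ≠ a₁) (ho2 : o ≠ a₂) (ho3 : o ≠ a₃)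
    (hb3 : b ≠ a₃) :
    NMixChord (normDZ2 ends a₁ a₂ a₃) p ends o a₁ a₂ a₃ b f :=
  nMixChord_DZ2_of_DZ hp
    (dzChord_o_edge₂_of_three_pin_star p ends b hp hf hg he hd hstar3 h12 h13 h23 ho1 ho2 ho3 hb3)
    (HCov_three_pin_star (Function.update p f 0) ends b (hp.update f le_rfl zero_le_one) hg he hd hstar3 h12
      h13 h23 ho3 hb3)

end Row

end OStar3

end Mix

end Summit.Ventures.PercRepro2
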